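import Summits.QuantumFields.YangMills.Theorems.BalabanUVNodesN15KingModelCovarianceOperatorBound
import Mathlib.Probability.Moments.Basic
import Mathlib.MeasureTheory.OuterMeasure.BorelCantelli
import Mathlib.Analysis.PSeries

/-!
# BalabanUVNodes ∕ N15 — THE KING-MODEL RUNG (PART Ϻ-w): SUB-GAUSSIAN TAILS OF THE INFINITE-VOLUME BLOCK FIELD AND ALMOST-SURE LOGARITHMIC GROWTH — Chernoff bounds
# `μ_∞{φ(f) ≥ a} ≤ e^{−a²∕2Var}` (`≤ e^{−a²m²∕2‖f‖²}`), `μ_∞{|φ(z)| ≥ a} ≤ 2e^{−a²∕2S₂^{ℝ}(0)}`, and by Borel–Cantelli `|φ(z)| < 2√(S₂^{ℝ}(0)Σ_ν log(2+|z_ν|))` for all but finitely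
# many `z`, `μ_∞`-almost surely (Track A, DAG node N15 = NE2; FAN-OUT v1.1 §N15 s3 «KING-MODEL RUNG»; uses parts Ϻ-n∕o∕t; count-neutral)

HONEST FRAMING.  Count-neutral (cell `pub-ymgap`, seat `pub-ymgap-dag-n15-e` g35; `--supports stmt-QuantumFields-27366 --as helper` = K3⁸).  King's `A = 0`, `g = 0` model
([King1986] C. King, Commun. Math. Phys. **102** (1986) 649–677).  Every field sum `φ(f) = Σ_jc_jφ(z_j)` is a centred Gaussian under `μ_∞` with variance
`V_f = Σc_jc_kS₂^{ℝ}(z_k − z_j)` (part Ϻ-o) `≤ m⁻²Σc_j²` (part Ϻ-t).  The Chernoff argument (Mathlib `measure_ge_le_exp_mul_mgf` + the exponential-moment formula) gives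
★★ `μ_∞{φ(f) ≥ a} ≤ exp(−a²∕2V_f) ≤ exp(−a²m²∕2Σc_j²)` and ★★ `μ_∞{|φ(z)| ≥ a} ≤ 2exp(−a²∕2S₂^{ℝ}(0)) ≤ 2exp(−a²m²∕2)`; with the summable lattice weights
`Π_ν(2+|z_ν|)^{−2}` the first Borel–Cantelli lemma yields ★★★ **almost-sure logarithmic growth**: `μ_∞`-a.s., `|φ(z)| < 2√(S₂^{ℝ}(0)·Σ_νlog(2+|z_ν|))` for all but finitely many
`z ∈ ℤ^{d+1}` — the typical block field grows at most like `√log|z|`.  NOT Bałaban's objects; NOT a node discharge; nothing continuum-Yang–Mills ∕ `ℝ⁴` ∕ OS ∕ Clay.  0 `sorry`, 0 def.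

WHAT THIS FILE PROVES (kernel).  §1 `chernoff_optimize`, ★ `measureReal_fieldSum_ge_le_exp` (Chernoff with free parameter), ★★ **`measureReal_fieldSum_ge_le`** (`e^{−a²∕2V}`), ★★ `measureReal_fieldSum_ge_le_mass`
(`e^{−a²m²∕2Σc²}`, injective sites).  §2 ★ `measureReal_abs_fieldSum_ge_le` (two-sided), ★★ **`measureReal_abs_eval_ge_le`** (`2e^{−a²∕2S₂(0)}`), `measureReal_abs_eval_ge_le_mass`.  §3 `summable_inv_two_add_abs_sq`,
★ `summable_pi_prod` (products of summable non-negative weights are summable on `ℤ^n`), `measureReal_abs_eval_ge_logWeight_le`, ★★★ **`ae_eventually_abs_eval_lt`**, `ae_eventually_abs_eval_lt_mass`.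

HONEST SCOPE.  King's free `K = |Ω| = ∞` block field; textbook Gaussian concentration, typed for `μ_∞`.  N15 untouched; counts unmoved.
Locators (use): [King1986] Thm 2.1 (2.22)–(2.23) p.654.
-/

noncomputable section

open scoped BigOperators Topology ENNReal
open Filter MeasureTheory ProbabilityTheory Finset

namespace Summit.QuantumFields.YangMills.BalabanUVNodes.N15KingModelRung.InfiniteVolume

open Summit.QuantumFields.YangMills.BalabanUVNodes.N15KingModelRung.OptimalDecay
open Summit.QuantumFields.YangMills.BalabanUVNodes.N15KingModelRung.ProperTime
open Literature.MathematicalPhysics.QuantumFieldTheory.King1986 (aliasBox)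

variable {d : ℕ}

/-! ## §1 Chernoff bounds for field sums -/

/-- The optimisation letter: if `P ≤ exp(−ta + t²W∕2)` for every `t ≥ 0` (`a, W ≥ 0`) then `P ≤ exp(−a²∕2W)` (`t = a∕W`; for `W = 0` both sides read `P ≤ 1`). [folklore] -/
theorem chernoff_optimize {P a W : ℝ} (ha : 0 ≤ a) (hW : 0 ≤ W) (h : ∀ t : ℝ, 0 ≤ t → P ≤ Real.exp (-t * a + t ^ 2 * W / 2)) :
    P ≤ Real.exp (-(a ^ 2 / (2 * W))) := by
  rcases hW.eq_or_lt with hW0 | hWpos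
  · rw [← hW0, mul_zero, div_zero, neg_zero, Real.exp_zero]
    have h0 := h 0 le_rfl
    rw [← hW0] at h0
    norm_num at h0
    exact h0
  · have h1 := h (a / W) (div_nonneg ha hWpos.le)
    have he : -(a / W) * a + (a / W) ^ 2 * W / 2 = -(a ^ 2 / (2 * W)) := by
      field_simp
      ring
    rw [he] at h1
    exact h1

/-- ★ **Chernoff with a free parameter**: `μ_∞{a ≤ Σ_jc_jφ(z_j)} ≤ exp(−ta + t²V∕2)` for every `t ≥ 0`, `V = Σc_jc_kS₂^{ℝ}(z_k − z_j)` the variance. [folklore] -/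
theorem measureReal_fieldSum_ge_le_exp {m2 : ℝ} (hm : 0 < m2) {J : Type*} (T : Finset J) (p : J → Fin (d + 1) → ℤ) (c : J → ℝ) (a : ℝ) {t : ℝ} (ht : 0 ≤ t) :
    (kingFieldInf m2).real {ω | a ≤ ∑ j ∈ T, c j * ω (p j)}
      ≤ Real.exp (-t * a + t ^ 2 * (∑ j ∈ T, ∑ j' ∈ T, c j * c j' * kingS2Inf m2 (p j' - p j)) / 2) := by
  haveI := isProbabilityMeasure_kingFieldInf (d := d) hm
  have hresc : ∀ ω : (Fin (d + 1) → ℤ) → ℝ, t * ∑ j ∈ T, c j * ω (p j) = ∑ j ∈ T, t * c j * ω (p j) := fun ω => by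
    rw [Finset.mul_sum]
    exact Finset.sum_congr rfl fun j _ => by ring
  have key := integral_exp_fieldSum hm T p (fun j => t * c j)
  have keyI := integrable_exp_fieldSum hm T p (fun j => t * c j)
  beta_reduce at key keyI
  have hint : Integrable (fun ω : (Fin (d + 1) → ℤ) → ℝ => Real.exp (t * ∑ j ∈ T, c j * ω (p j))) (kingFieldInf m2) := by
    simp_rw [hresc]; exact keyI
  have h := measure_ge_le_exp_mul_mgf (μ := kingFieldInf m2) (X := fun ω : (Fin (d + 1) → ℤ) → ℝ => ∑ j ∈ T, c j * ω (p j)) a ht hint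
  have hmgf : mgf (fun ω : (Fin (d + 1) → ℤ) → ℝ => ∑ j ∈ T, c j * ω (p j)) (kingFieldInf m2) t
      = Real.exp (t ^ 2 * (∑ j ∈ T, ∑ j' ∈ T, c j * c j' * kingS2Inf m2 (p j' - p j)) / 2) := by
    simp only [mgf]
    simp_rw [hresc]
    rw [key]
    congr 2
    rw [Finset.mul_sum]
    refine Finset.sum_congr rfl fun j _ => ?_
    rw [Finset.mul_sum]
    exact Finset.sum_congr rfl fun j' _ => by ring
  rw [hmgf, ← Real.exp_add] at h
  exact h

/-- ★★ **THE SUB-GAUSSIAN UPPER TAIL**: `μ_∞{a ≤ Σ_jc_jφ(z_j)} ≤ exp(−a²∕2V)` (`a ≥ 0`, `V` the variance). [folklore] -/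
theorem measureReal_fieldSum_ge_le {m2 : ℝ} (hm : 0 < m2) {J : Type*} (T : Finset J) (p : J → Fin (d + 1) → ℤ) (c : J → ℝ) {a : ℝ} (ha : 0 ≤ a) :
    (kingFieldInf m2).real {ω | a ≤ ∑ j ∈ T, c j * ω (p j)} ≤ Real.exp (-(a ^ 2 / (2 * ∑ j ∈ T, ∑ j' ∈ T, c j * c j' * kingS2Inf m2 (p j' - p j)))) := by
  have hV : 0 ≤ ∑ j ∈ T, ∑ j' ∈ T, c j * c j' * kingS2Inf m2 (p j' - p j) := by
    rw [← variance_fieldSum hm T p c]; exact variance_nonneg _ _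
  exact chernoff_optimize ha hV fun t ht => measureReal_fieldSum_ge_le_exp hm T p c a ht

/-- ★★ **THE TAIL IN TERMS OF THE MASS**: for injective sites, `μ_∞{a ≤ Σ_jc_jφ(z_j)} ≤ exp(−a²m²∕2Σ_jc_j²)` (`a ≥ 0`; part Ϻ-t's `V ≤ m⁻²Σc_j²`). [cite: King1986, Thm 2.1 (2.23) p.654] -/
theorem measureReal_fieldSum_ge_le_mass {m2 : ℝ} (hm : 0 < m2) {J : Type*} (T : Finset J) {p : J → Fin (d + 1) → ℤ} (hp : Function.Injective p) (c : J → ℝ) {a : ℝ}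
    (ha : 0 ≤ a) : (kingFieldInf m2).real {ω | a ≤ ∑ j ∈ T, c j * ω (p j)} ≤ Real.exp (-(a ^ 2 * m2 / (2 * ∑ j ∈ T, c j ^ 2))) := by
  haveI := isProbabilityMeasure_kingFieldInf (d := d) hm
  rcases (Finset.sum_nonneg fun j (_ : j ∈ T) => sq_nonneg (c j)).eq_or_lt with hS | hS
  · rw [← hS, mul_zero, div_zero, neg_zero, Real.exp_zero]
    exact measureReal_le_one
  have hW : 0 ≤ m2⁻¹ * ∑ j ∈ T, c j ^ 2 := by positivity
  have hV := variance_fieldSum_le hm T hp c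
  rw [variance_fieldSum hm T p c] at hV
  have h := chernoff_optimize (P := (kingFieldInf m2).real {ω | a ≤ ∑ j ∈ T, c j * ω (p j)}) ha hW fun t ht =>
    (measureReal_fieldSum_ge_le_exp hm T p c a ht).trans (Real.exp_le_exp.mpr (by nlinarith [sq_nonneg t]))
  have he : a ^ 2 / (2 * (m2⁻¹ * ∑ j ∈ T, c j ^ 2)) = a ^ 2 * m2 / (2 * ∑ j ∈ T, c j ^ 2) := by
    field_simp
  rw [he] at h
  exact h

/-! ## §2 Two-sided tails and the single-site bound -/

/-- ★ **Two-sided tail**: `μ_∞{a ≤ |Σ_jc_jφ(z_j)|} ≤ 2exp(−a²∕2V)` (`a ≥ 0`). [folklore] -/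
theorem measureReal_abs_fieldSum_ge_le {m2 : ℝ} (hm : 0 < m2) {J : Type*} (T : Finset J) (p : J → Fin (d + 1) → ℤ) (c : J → ℝ) {a : ℝ} (ha : 0 ≤ a) :
    (kingFieldInf m2).real {ω | a ≤ |∑ j ∈ T, c j * ω (p j)|} ≤ 2 * Real.exp (-(a ^ 2 / (2 * ∑ j ∈ T, ∑ j' ∈ T, c j * c j' * kingS2Inf m2 (p j' - p j)))) := by
  haveI := isProbabilityMeasure_kingFieldInf (d := d) hm
  have hneg : ∀ ω : (Fin (d + 1) → ℤ) → ℝ, ∑ j ∈ T, -c j * ω (p j) = -∑ j ∈ T, c j * ω (p j) := fun ω => by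
    rw [← Finset.sum_neg_distrib]; exact Finset.sum_congr rfl fun j _ => by ring
  have hsub : {ω : (Fin (d + 1) → ℤ) → ℝ | a ≤ |∑ j ∈ T, c j * ω (p j)|}
      ⊆ {ω | a ≤ ∑ j ∈ T, c j * ω (p j)} ∪ {ω | a ≤ ∑ j ∈ T, -c j * ω (p j)} := by
    intro ω hω
    simp only [Set.mem_setOf_eq, Set.mem_union] at hω ⊢
    rw [abs_eq_max_neg, le_max_iff] at hω
    rcases hω with h | h
    · exact Or.inl h
    · exact Or.inr (by rw [hneg]; exact h)
  have h1 := measureReal_fieldSum_ge_le hm T p c ha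
  have h2 := measureReal_fieldSum_ge_le hm T p (fun j => -c j) ha
  have hV : ∑ j ∈ T, ∑ j' ∈ T, (fun j => -c j) j * (fun j => -c j) j' * kingS2Inf m2 (p j' - p j) = ∑ j ∈ T, ∑ j' ∈ T, c j * c j' * kingS2Inf m2 (p j' - p j) :=
    Finset.sum_congr rfl fun j _ => Finset.sum_congr rfl fun j' _ => by ring
  rw [hV] at h2
  calc (kingFieldInf m2).real {ω | a ≤ |∑ j ∈ T, c j * ω (p j)|}
      ≤ (kingFieldInf m2).real ({ω | a ≤ ∑ j ∈ T, c j * ω (p j)} ∪ {ω | a ≤ ∑ j ∈ T, -c j * ω (p j)}) := measureReal_mono hsub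
    _ ≤ (kingFieldInf m2).real {ω | a ≤ ∑ j ∈ T, c j * ω (p j)} + (kingFieldInf m2).real {ω | a ≤ ∑ j ∈ T, -c j * ω (p j)} := measureReal_union_le _ _
    _ ≤ _ := by linarith

/-- ★★ **THE SINGLE-SITE TAIL**: `μ_∞{a ≤ |φ(z)|} ≤ 2exp(−a²∕2S₂^{ℝ}(0))` (`a ≥ 0`; `Var_{μ_∞}φ(z) = S₂^{ℝ}(0)`). [cite: King1986, Thm 2.1 (2.22) p.654] -/
theorem measureReal_abs_eval_ge_le {m2 : ℝ} (hm : 0 < m2) (z : Fin (d + 1) → ℤ) {a : ℝ} (ha : 0 ≤ a) :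
    (kingFieldInf m2).real {ω | a ≤ |ω z|} ≤ 2 * Real.exp (-(a ^ 2 / (2 * kingS2Inf m2 (0 : Fin (d + 1) → ℤ)))) := by
  have h := measureReal_abs_fieldSum_ge_le hm (Finset.univ : Finset Unit) (fun _ => z) (fun _ => (1 : ℝ)) ha
  simp only [Finset.univ_unique, Finset.sum_singleton, one_mul, sub_self] at h
  exact h

/-- `μ_∞{a ≤ |φ(z)|} ≤ 2exp(−a²m²∕2)` (`S₂^{ℝ}(0) ≤ m⁻²`). [cite: King1986, Thm 2.1 (2.23) p.654] -/
theorem measureReal_abs_eval_ge_le_mass {m2 : ℝ} (hm : 0 < m2) (z : Fin (d + 1) → ℤ) {a : ℝ} (ha : 0 ≤ a) :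
    (kingFieldInf m2).real {ω | a ≤ |ω z|} ≤ 2 * Real.exp (-(a ^ 2 * m2 / 2)) := by
  obtain ⟨hS0, hS1⟩ := kingS2Inf_pos_le hm (0 : Fin (d + 1) → ℤ)
  refine (measureReal_abs_eval_ge_le hm z ha).trans (mul_le_mul_of_nonneg_left (Real.exp_le_exp.mpr (neg_le_neg ?_)) zero_le_two)
  have hmS : m2 * kingS2Inf m2 (0 : Fin (d + 1) → ℤ) ≤ 1 := by
    calc m2 * kingS2Inf m2 (0 : Fin (d + 1) → ℤ) ≤ m2 * m2⁻¹ := mul_le_mul_of_nonneg_left hS1 hm.le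
      _ = 1 := mul_inv_cancel₀ hm.ne'
  rw [le_div_iff₀ (by positivity)]
  nlinarith [mul_nonneg (sq_nonneg a) (sub_nonneg.mpr hmS)]

/-! ## §3 Borel–Cantelli: almost-sure logarithmic growth -/

/-- `Σ_{k∈ℤ}(2+|k|)^{−2} < ∞`. [folklore] -/
theorem summable_inv_two_add_abs_sq : Summable fun k : ℤ => ((2 + |(k : ℝ)|) ^ 2)⁻¹ := by
  have h1 : Summable fun n : ℤ => 1 / (n : ℝ) ^ 2 := Real.summable_one_div_int_pow.mpr one_lt_two
  have h2 : Summable fun n : ℤ => if n = 0 then ((2 : ℝ) ^ 2)⁻¹ else 0 := by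
    refine summable_of_ne_finset_zero (s := {0}) fun n hn => ?_
    rw [Finset.mem_singleton] at hn
    simp [hn]
  refine Summable.of_nonneg_of_le (fun k => by positivity) (fun k => ?_) (h1.add h2)
  by_cases hk : k = 0
  · subst hk
    norm_num
  · have hk' : (k : ℝ) ≠ 0 := Int.cast_ne_zero.mpr hk
    have hk2 : 0 < (k : ℝ) ^ 2 := sq_pos_iff.mpr hk'
    simp only [hk, if_false, add_zero, one_div]
    exact inv_anti₀ hk2 (by nlinarith [abs_nonneg (k : ℝ), sq_abs (k : ℝ)])

/-- ★ **Products of summable non-negative weights are summable on `ℤ^n`**: `Σ_{z∈ℤ^n}Π_νg(z_ν) < ∞`. [folklore] -/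
theorem summable_pi_prod {n : ℕ} {g : ℤ → ℝ} (hg0 : ∀ k, 0 ≤ g k) (hg : Summable g) : Summable fun z : Fin n → ℤ => ∏ ν, g (z ν) := by
  refine summable_of_sum_le (c := (∑' k, g k) ^ n) (fun z => Finset.prod_nonneg fun ν _ => hg0 _) fun u => ?_
  obtain ⟨N, hN⟩ := exists_subset_aliasBox u
  refine (Finset.sum_le_sum_of_subset_of_nonneg hN fun z _ _ => Finset.prod_nonneg fun ν _ => hg0 _).trans ?_
  unfold aliasBox
  rw [← Finset.prod_univ_sum (fun _ : Fin n => Finset.Icc (-(N : ℤ)) N) (fun (_ : Fin n) (k : ℤ) => g k)]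
  calc ∏ _ν : Fin n, ∑ k ∈ Finset.Icc (-(N : ℤ)) N, g k ≤ ∏ _ν : Fin n, ∑' k, g k :=
        Finset.prod_le_prod (fun _ _ => Finset.sum_nonneg fun k _ => hg0 k) fun _ _ => hg.sum_le_tsum _ fun k _ => hg0 k
    _ = (∑' k, g k) ^ n := by rw [Finset.prod_const, Finset.card_univ, Fintype.card_fin]

/-- At the logarithmic threshold `a_z = 2√(S₂^{ℝ}(0)Σ_νlog(2+|z_ν|))`: `μ_∞{a_z ≤ |φ(z)|} ≤ 2Π_ν(2+|z_ν|)^{−2}`. [folklore] -/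
theorem measureReal_abs_eval_ge_logWeight_le {m2 : ℝ} (hm : 0 < m2) (z : Fin (d + 1) → ℤ) :
    (kingFieldInf m2).real {ω | 2 * Real.sqrt (kingS2Inf m2 (0 : Fin (d + 1) → ℤ) * ∑ ν, Real.log (2 + |(z ν : ℝ)|)) ≤ |ω z|} ≤ 2 * ∏ ν, ((2 + |(z ν : ℝ)|) ^ 2)⁻¹ := by
  have hσ : 0 < kingS2Inf m2 (0 : Fin (d + 1) → ℤ) := kingS2Inf_pos hm 0
  have hσne : kingS2Inf m2 (0 : Fin (d + 1) → ℤ) ≠ 0 := hσ.ne'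
  have hL : 0 ≤ ∑ ν, Real.log (2 + |(z ν : ℝ)|) := Finset.sum_nonneg fun ν _ => Real.log_nonneg (by linarith [abs_nonneg (z ν : ℝ)])
  have h := measureReal_abs_eval_ge_le hm z (a := 2 * Real.sqrt (kingS2Inf m2 (0 : Fin (d + 1) → ℤ) * ∑ ν, Real.log (2 + |(z ν : ℝ)|))) (by positivity)
  have hexp : Real.exp (-((2 * Real.sqrt (kingS2Inf m2 (0 : Fin (d + 1) → ℤ) * ∑ ν, Real.log (2 + |(z ν : ℝ)|))) ^ 2 / (2 * kingS2Inf m2 (0 : Fin (d + 1) → ℤ)))) = ∏ ν, ((2 + |(z ν : ℝ)|) ^ 2)⁻¹ := by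
    rw [mul_pow, Real.sq_sqrt (mul_nonneg hσ.le hL),
      show -((2 : ℝ) ^ 2 * (kingS2Inf m2 (0 : Fin (d + 1) → ℤ) * ∑ ν, Real.log (2 + |(z ν : ℝ)|)) / (2 * kingS2Inf m2 (0 : Fin (d + 1) → ℤ))) = ∑ ν, -(2 * Real.log (2 + |(z ν : ℝ)|)) by
        rw [Finset.sum_neg_distrib, ← Finset.mul_sum]; field_simp,
      Real.exp_sum]
    refine Finset.prod_congr rfl fun ν _ => ?_
    have h2 : 0 < 2 + |(z ν : ℝ)| := by positivity
    rw [Real.exp_neg, two_mul, Real.exp_add, Real.exp_log h2, sq]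
  rw [hexp] at h
  exact h

/-- ★★★ **ALMOST-SURE LOGARITHMIC GROWTH OF THE BLOCK FIELD**: `μ_∞`-almost surely, `|φ(z)| < 2√(S₂^{ℝ}(0)·Σ_νlog(2+|z_ν|))` for all but finitely many `z ∈ ℤ^{d+1}` (first Borel–Cantelli
lemma with the summable weights `2Π_ν(2+|z_ν|)^{−2}`). [folklore] -/
theorem ae_eventually_abs_eval_lt {m2 : ℝ} (hm : 0 < m2) :
    ∀ᵐ ω ∂kingFieldInf m2, ∀ᶠ z : Fin (d + 1) → ℤ in cofinite, |ω z| < 2 * Real.sqrt (kingS2Inf m2 (0 : Fin (d + 1) → ℤ) * ∑ ν, Real.log (2 + |(z ν : ℝ)|)) := by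
  haveI := isProbabilityMeasure_kingFieldInf (d := d) hm
  have hw0 : ∀ z : Fin (d + 1) → ℤ, 0 ≤ 2 * ∏ ν, ((2 + |(z ν : ℝ)|) ^ 2)⁻¹ := fun z => by positivity
  have hws : Summable fun z : Fin (d + 1) → ℤ => 2 * ∏ ν, ((2 + |(z ν : ℝ)|) ^ 2)⁻¹ :=
    (summable_pi_prod (g := fun k : ℤ => ((2 + |(k : ℝ)|) ^ 2)⁻¹) (fun k => by positivity) summable_inv_two_add_abs_sq).mul_left 2
  have hsum : ∑' z : Fin (d + 1) → ℤ, kingFieldInf m2 {ω | 2 * Real.sqrt (kingS2Inf m2 (0 : Fin (d + 1) → ℤ) * ∑ ν, Real.log (2 + |(z ν : ℝ)|)) ≤ |ω z|} ≠ ∞ := by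
    refine ne_top_of_le_ne_top (b := ENNReal.ofReal (∑' z : Fin (d + 1) → ℤ, 2 * ∏ ν, ((2 + |(z ν : ℝ)|) ^ 2)⁻¹)) ENNReal.ofReal_ne_top ?_
    calc ∑' z : Fin (d + 1) → ℤ, kingFieldInf m2 {ω | 2 * Real.sqrt (kingS2Inf m2 (0 : Fin (d + 1) → ℤ) * ∑ ν, Real.log (2 + |(z ν : ℝ)|)) ≤ |ω z|}
        ≤ ∑' z : Fin (d + 1) → ℤ, ENNReal.ofReal (2 * ∏ ν, ((2 + |(z ν : ℝ)|) ^ 2)⁻¹) := ENNReal.tsum_le_tsum fun z => by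
          rw [← ofReal_measureReal (measure_ne_top _ _)]
          exact ENNReal.ofReal_le_ofReal (measureReal_abs_eval_ge_logWeight_le hm z)
      _ = ENNReal.ofReal (∑' z : Fin (d + 1) → ℤ, 2 * ∏ ν, ((2 + |(z ν : ℝ)|) ^ 2)⁻¹) := (ENNReal.ofReal_tsum_of_nonneg hw0 hws).symm
  filter_upwards [ae_finite_setOf_mem (μ := kingFieldInf m2) hsum] with ω hω
  rw [Filter.eventually_cofinite]
  refine hω.subset fun z hz => ?_
  simp only [Set.mem_setOf_eq, not_lt] at hz ⊢
  exact hz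

/-- ★★ The same with the mass: `μ_∞`-a.s., `|φ(z)| < 2√(m⁻²Σ_νlog(2+|z_ν|))` for all but finitely many `z`. [cite: King1986, Thm 2.1 (2.23) p.654] -/
theorem ae_eventually_abs_eval_lt_mass {m2 : ℝ} (hm : 0 < m2) :
    ∀ᵐ ω ∂kingFieldInf m2, ∀ᶠ z : Fin (d + 1) → ℤ in cofinite, |ω z| < 2 * Real.sqrt (m2⁻¹ * ∑ ν, Real.log (2 + |(z ν : ℝ)|)) := by
  have hS1 := (kingS2Inf_pos_le hm (0 : Fin (d + 1) → ℤ)).2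
  filter_upwards [ae_eventually_abs_eval_lt hm] with ω hω
  refine hω.mono fun z hz => hz.trans_le (mul_le_mul_of_nonneg_left (Real.sqrt_le_sqrt (mul_le_mul_of_nonneg_right hS1 ?_)) zero_le_two)
  exact Finset.sum_nonneg fun ν _ => Real.log_nonneg (by linarith [abs_nonneg (z ν : ℝ)])

end Summit.QuantumFields.YangMills.BalabanUVNodes.N15KingModelRung.InfiniteVolume
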